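import Literature.Analysis.Distribution.BracketGeneratingGerms
import Literature.Analysis.Distribution.BracketSpanRescale
import HarnessLib

/-!
# The bracket condition without the bare drift word, and its lift to space-time

Topic `Literature/Analysis/Distribution`. Generic tools for the bracket condition of the
PARABOLIC operator `∂_t - L` (or `L* - ∂_t`) on `ℝ × E` built from a Hörmander operator
`L = ∑ X_j² + X₀` on `E`: its fields are the lifts `X̃_j = (0, X_j)`, `X̃₀ = (a, X₀)` with a
non-zero time component `a`, and since brackets kill constant time components
(`[(a, V), (b, W)] = (0, [V, W])`, `lieBracket_liftField`), the lifted family is bracket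
generating on `ℝ × E` as soon as the ORIGINAL family generates `E` **without using the bare word
`X₀`** — i.e. with the bare noise fields and the brackets of length `≥ 2` only — which is what the
printed verifications (Rey-Bellet–Thomas 2002 Prop. 4.1, Cuneo–Eckmann–Hairer–Rey-Bellet 2018
Prop. 4.1) actually establish. This file provides:

* `IsProperIteratedLieBracket X` — the right-nested brackets of length `≥ 2`;
  `lieSpanMod X A` — the `ℝ`-span of these and of the bare `X_i`, `i ∈ A` (the allowed bare
  words); it is closed under bracketing with EVERY `X_i` (`lieBracket_family_mem_lieSpanMod`) and
  under the bracket of two members (`lieBracket_mem_lieSpanMod`, Jacobi);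
* `InGermModuleMod X A x₀` — the germ `C^∞`-module it generates at `x₀` (same closure properties
  as `InGermModule` of `BracketGeneratingGerms.lean`, plus `lieBracket_family_left/right` with any
  member of the family) and `bracketSpanModAt`, `bracketSpanModAt_eq_top_of_inGermModuleMod`;
* `bracketSpanModAt_eq_of_eq_smul` — invariance under rescaling the fields by non-zero constants;
* `liftField a V = (t, y) ↦ (a, V y)`, `lieBracket_liftField`, and
  **`isBracketGenerating_lift`**: if `bracketSpanModAt X {i | c i = 0} y = ⊤` for `y ∈ s` and some
  `c i₀ ≠ 0`, then the lifted family `i ↦ liftField (c i) (X i)` is bracket generating on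
  `univ ×ˢ s`.

## References

* L. Hörmander, Acta Math. **119** (1967) 147–171, Thm 1.1 (the bracket condition; the example
  of Kolmogorov's operator `∂²_x + x∂_y - ∂_t`, p. 148).
* L. Rey-Bellet, L. E. Thomas, Comm. Math. Phys. **225** (2002) 305–329, §4 (Hörmander's theorem
  for the parabolic problem: "the Markov process has a `C^∞` law").
-/

noncomputable section

open Set Filter VectorField
open scoped ContDiff Topology

namespace Literature.Analysis.Distribution

variable {E : Type*} [NormedAddCommGroup E] [NormedSpace ℝ E] {κ : Type*} {X : κ → E → E}
  {A : Set κ}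

/-! ### Brackets of length at least two, and the span without the forbidden bare words -/

variable (X) in
/-- The right-nested iterated brackets of LENGTH AT LEAST TWO: `[X_i, V]` with `V` an iterated
bracket. [folklore] -/
inductive IsProperIteratedLieBracket : (E → E) → Prop
  | lieBracket (i : κ) {V : E → E} (hV : IsIteratedLieBracket X V) :
      IsProperIteratedLieBracket (lieBracket ℝ (X i) V)

/-- Proper iterated brackets are iterated brackets. [folklore] -/
theorem IsProperIteratedLieBracket.isIteratedLieBracket {V : E → E}
    (hV : IsProperIteratedLieBracket X V) : IsIteratedLieBracket X V := by
  cases hV with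
  | lieBracket i hV => exact IsIteratedLieBracket.lieBracket i hV

variable (X A) in
/-- The `ℝ`-span of the brackets of length `≥ 2` together with the bare fields `X_i`, `i ∈ A`
(the bare words outside `A` — typically the drift `X₀` — are excluded). [folklore] -/
def lieSpanMod : Submodule ℝ (E → E) :=
  Submodule.span ℝ {V | (∃ i ∈ A, V = X i) ∨ IsProperIteratedLieBracket X V}

variable (X A) in
/-- The span of the values at `x` of the generators of `lieSpanMod`. [folklore] -/
def bracketSpanModAt (x : E) : Submodule ℝ E :=
  Submodule.span ℝ {v | ∃ V : E → E, ((∃ i ∈ A, V = X i) ∨ IsProperIteratedLieBracket X V) ∧ V x = v}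

/-- Generators of `lieSpanMod` are iterated brackets. [folklore] -/
theorem isIteratedLieBracket_of_gen {V : E → E}
    (hV : (∃ i ∈ A, V = X i) ∨ IsProperIteratedLieBracket X V) : IsIteratedLieBracket X V := by
  rcases hV with ⟨i, -, rfl⟩ | hV
  · exact IsIteratedLieBracket.of i
  · exact hV.isIteratedLieBracket

/-- `lieSpanMod ≤ lieSpan`. [folklore] -/
theorem lieSpanMod_le_lieSpan : lieSpanMod X A ≤ lieSpan X :=
  Submodule.span_le.2 fun _ hV => (isIteratedLieBracket_of_gen hV).mem_lieSpan

/-- `bracketSpanModAt ≤ bracketSpanAt`. [folklore] -/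
theorem bracketSpanModAt_le_bracketSpanAt (x : E) : bracketSpanModAt X A x ≤ bracketSpanAt X x :=
  Submodule.span_mono fun _ ⟨V, hV, hv⟩ => ⟨V, isIteratedLieBracket_of_gen hV, hv⟩

/-- Allowed bare fields are in `lieSpanMod`. [folklore] -/
theorem mem_lieSpanMod_of {i : κ} (hi : i ∈ A) : X i ∈ lieSpanMod X A :=
  Submodule.subset_span (Or.inl ⟨i, hi, rfl⟩)

/-- Proper iterated brackets are in `lieSpanMod`. [folklore] -/
theorem IsProperIteratedLieBracket.mem_lieSpanMod {V : E → E} (hV : IsProperIteratedLieBracket X V) :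
    V ∈ lieSpanMod X A :=
  Submodule.subset_span (Or.inr hV)

/-- Elements of `lieSpanMod` of a smooth family are smooth. [folklore] -/
theorem contDiff_of_mem_lieSpanMod (hX : ∀ i, ContDiff ℝ ∞ (X i)) {V : E → E}
    (hV : V ∈ lieSpanMod X A) : ContDiff ℝ ∞ V :=
  contDiff_of_mem_lieSpan hX (lieSpanMod_le_lieSpan hV)

/-- The value at `x` of an element of `lieSpanMod` lies in `bracketSpanModAt x`. [folklore] -/
theorem apply_mem_bracketSpanModAt {V : E → E} (hV : V ∈ lieSpanMod X A) (x : E) :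
    V x ∈ bracketSpanModAt X A x := by
  induction hV using Submodule.span_induction with
  | mem V hV => exact Submodule.subset_span ⟨V, hV, rfl⟩
  | zero => exact Submodule.zero_mem _
  | add V W _ _ hV hW => exact Submodule.add_mem _ hV hW
  | smul c V _ hV => exact Submodule.smul_mem _ c hV

/-- **`lieSpanMod` is stable under bracketing with ANY member of the family on the left**
(the bracket raises the length, so no bare word is produced). [folklore] -/
theorem lieBracket_family_mem_lieSpanMod (hX : ∀ i, ContDiff ℝ ∞ (X i)) (i : κ) {V : E → E}
    (hV : V ∈ lieSpanMod X A) : lieBracket ℝ (X i) V ∈ lieSpanMod X A := by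
  induction hV using Submodule.span_induction with
  | mem V hV =>
    exact (IsProperIteratedLieBracket.lieBracket i (isIteratedLieBracket_of_gen hV)).mem_lieSpanMod
  | zero => rw [lieBracket_zero_right]; exact Submodule.zero_mem _
  | add V W hV hW ihV ihW =>
    have hVd := (contDiff_of_mem_lieSpanMod hX hV).differentiable (by simp)
    have hWd := (contDiff_of_mem_lieSpanMod hX hW).differentiable (by simp)
    have e : lieBracket ℝ (X i) (V + W) = lieBracket ℝ (X i) V + lieBracket ℝ (X i) W := by
      funext y
      exact lieBracket_add_right (hVd y) (hWd y)
    rw [e]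
    exact Submodule.add_mem _ ihV ihW
  | smul c V hV ihV =>
    have hVd := (contDiff_of_mem_lieSpanMod hX hV).differentiable (by simp)
    have e : lieBracket ℝ (X i) (c • V) = c • lieBracket ℝ (X i) V := by
      funext y
      exact lieBracket_const_smul_right (hVd y)
    rw [e]
    exact Submodule.smul_mem _ c ihV

/-- `lieSpanMod` is stable under bracketing with any member of the family on the right.
[folklore] -/
theorem lieBracket_family_right_mem_lieSpanMod (hX : ∀ i, ContDiff ℝ ∞ (X i)) (i : κ) {V : E → E}
    (hV : V ∈ lieSpanMod X A) : lieBracket ℝ V (X i) ∈ lieSpanMod X A := by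
  have e : lieBracket ℝ V (X i) = -lieBracket ℝ (X i) V := by
    funext y; rw [Pi.neg_apply]; exact lieBracket_swap
  rw [e]
  exact Submodule.neg_mem _ (lieBracket_family_mem_lieSpanMod hX i hV)

/-- The bracket of an iterated bracket `U` with an element of `lieSpanMod` is in `lieSpanMod`
(induction on `U`, Jacobi). [folklore] -/
theorem IsIteratedLieBracket.lieBracket_mem_lieSpanMod (hX : ∀ i, ContDiff ℝ ∞ (X i)) {U : E → E}
    (hU : IsIteratedLieBracket X U) :
    ∀ {V : E → E}, V ∈ lieSpanMod X A → VectorField.lieBracket ℝ U V ∈ lieSpanMod X A := by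
  induction hU with
  | of i => exact fun hV => lieBracket_family_mem_lieSpanMod hX i hV
  | lieBracket i hU' ih =>
    intro V hV
    rename_i U'
    have hXi : ContDiff ℝ ∞ (X i) := hX i
    have hU'c : ContDiff ℝ ∞ U' := hU'.contDiff hX
    have hVc : ContDiff ℝ ∞ V := contDiff_of_mem_lieSpanMod hX hV
    have e : VectorField.lieBracket ℝ (VectorField.lieBracket ℝ (X i) U') V =
        VectorField.lieBracket ℝ (X i) (VectorField.lieBracket ℝ U' V) -
          VectorField.lieBracket ℝ U' (VectorField.lieBracket ℝ (X i) V) := by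
      funext y
      have h := leibniz_identity_lieBracket (𝕜 := ℝ) (n := ∞)
        (by rw [minSmoothness_of_isRCLikeNormedField]; exact WithTop.coe_le_coe.2 le_top) hXi.contDiffAt
        hU'c.contDiffAt hVc.contDiffAt (U := X i) (V := U') (W := V) (x := y)
      rw [Pi.sub_apply]
      exact eq_sub_of_add_eq h.symm
    rw [e]
    exact Submodule.sub_mem _ (lieBracket_family_mem_lieSpanMod hX i (ih hV))
      (ih (lieBracket_family_mem_lieSpanMod hX i hV))

/-- **`lieSpanMod` is closed under the bracket.** [folklore] -/
theorem lieBracket_mem_lieSpanMod (hX : ∀ i, ContDiff ℝ ∞ (X i)) {U V : E → E}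
    (hU : U ∈ lieSpanMod X A) (hV : V ∈ lieSpanMod X A) : lieBracket ℝ U V ∈ lieSpanMod X A := by
  induction hU using Submodule.span_induction with
  | mem U hU => exact (isIteratedLieBracket_of_gen hU).lieBracket_mem_lieSpanMod hX hV
  | zero => rw [lieBracket_zero_left]; exact Submodule.zero_mem _
  | add U W hU hW ihU ihW =>
    have hUd := (contDiff_of_mem_lieSpanMod hX hU).differentiable (by simp)
    have hWd := (contDiff_of_mem_lieSpanMod hX hW).differentiable (by simp)
    have e : lieBracket ℝ (U + W) V = lieBracket ℝ U V + lieBracket ℝ W V := by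
      funext y
      exact lieBracket_add_left (hUd y) (hWd y)
    rw [e]
    exact Submodule.add_mem _ ihU ihW
  | smul c U hU ihU =>
    have hUd := (contDiff_of_mem_lieSpanMod hX hU).differentiable (by simp)
    have e : lieBracket ℝ (c • U) V = c • lieBracket ℝ U V := by
      funext y
      exact lieBracket_const_smul_left (hUd y)
    rw [e]
    exact Submodule.smul_mem _ c ihU

/-! ### The germ module without the forbidden bare words -/

variable (X A) in
/-- The germ at `x₀` of the `C^∞`-module generated by `lieSpanMod X A` (cf. `InGermModule`).
[folklore] -/
inductive InGermModuleMod (x₀ : E) : (E → E) → Prop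
  | mem {V : E → E} (hV : V ∈ lieSpanMod X A) : InGermModuleMod x₀ V
  | add {V W : E → E} : InGermModuleMod x₀ V → InGermModuleMod x₀ W → InGermModuleMod x₀ (V + W)
  | smul {f : E → ℝ} {V : E → E} (hf : ∀ᶠ y in 𝓝 x₀, ContDiffAt ℝ ∞ f y) :
      InGermModuleMod x₀ V → InGermModuleMod x₀ (fun y => f y • V y)
  | congr {V W : E → E} : InGermModuleMod x₀ V → W =ᶠ[𝓝 x₀] V → InGermModuleMod x₀ W

namespace InGermModuleMod

variable {x₀ : E}

/-- Members of the restricted germ module are in the full germ module. [folklore] -/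
theorem inGermModule {V : E → E} (hV : InGermModuleMod X A x₀ V) : InGermModule X x₀ V := by
  induction hV with
  | mem hV => exact InGermModule.mem (lieSpanMod_le_lieSpan hV)
  | add _ _ ihV ihW => exact ihV.add ihW
  | smul hf _ ih => exact ih.smul hf
  | congr _ hWV ih => exact ih.congr hWV

/-- The zero field is in the germ module. [folklore] -/
theorem zero : InGermModuleMod X A x₀ 0 := mem (Submodule.zero_mem _)

/-- Constant multiples stay in the germ module. [folklore] -/
theorem const_smul (c : ℝ) {V : E → E} (hV : InGermModuleMod X A x₀ V) :
    InGermModuleMod X A x₀ (c • V) := by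
  have h := smul (f := fun _ => c) (Eventually.of_forall fun _ => contDiffAt_const) hV
  exact h

/-- Negatives stay in the germ module. [folklore] -/
theorem neg {V : E → E} (hV : InGermModuleMod X A x₀ V) : InGermModuleMod X A x₀ (-V) := by
  have h := hV.const_smul (-1)
  rwa [neg_one_smul] at h

/-- Differences stay in the germ module. [folklore] -/
theorem sub {V W : E → E} (hV : InGermModuleMod X A x₀ V) (hW : InGermModuleMod X A x₀ W) :
    InGermModuleMod X A x₀ (V - W) := by
  rw [sub_eq_add_neg]
  exact hV.add hW.neg

/-- Finite sums stay in the germ module. [folklore] -/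
theorem finset_sum {ι : Type*} (s : Finset ι) {F : ι → E → E}
    (h : ∀ i ∈ s, InGermModuleMod X A x₀ (F i)) : InGermModuleMod X A x₀ (∑ i ∈ s, F i) := by
  classical
  induction s using Finset.induction_on with
  | empty => rw [Finset.sum_empty]; exact zero
  | insert a s ha ih =>
    rw [Finset.sum_insert ha]
    exact (h a (Finset.mem_insert_self a s)).add (ih fun i hi => h i (Finset.mem_insert_of_mem hi))

/-- Members of the germ module are smooth at every point near `x₀`. [folklore] -/
theorem eventually_contDiffAt (hX : ∀ i, ContDiff ℝ ∞ (X i)) {V : E → E}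
    (hV : InGermModuleMod X A x₀ V) : ∀ᶠ y in 𝓝 x₀, ContDiffAt ℝ ∞ V y :=
  hV.inGermModule.eventually_contDiffAt hX

/-- **Values at `x₀` of the germ module lie in the restricted span at `x₀`.** [folklore] -/
theorem apply_mem {V : E → E} (hV : InGermModuleMod X A x₀ V) : V x₀ ∈ bracketSpanModAt X A x₀ := by
  induction hV with
  | mem hV => exact apply_mem_bracketSpanModAt hV x₀
  | add _ _ ihV ihW => exact Submodule.add_mem _ ihV ihW
  | smul _ _ ih => exact Submodule.smul_mem _ _ ih
  | congr _ hWV ih => rw [show _ = _ from hWV.self_of_nhds]; exact ih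

/-- The germ module is stable under bracketing on the left with a smooth field `U` such that
`[U, ·]` preserves `lieSpanMod` (e.g. a member of the family, or of `lieSpanMod`). [folklore] -/
theorem lieBracket_right_of {U : E → E} (hX : ∀ i, ContDiff ℝ ∞ (X i)) (hUc : ContDiff ℝ ∞ U)
    (hU : ∀ W, W ∈ lieSpanMod X A → lieBracket ℝ U W ∈ lieSpanMod X A)
    {W : E → E} (hW : InGermModuleMod X A x₀ W) : InGermModuleMod X A x₀ (lieBracket ℝ U W) := by
  induction hW with
  | mem hW => exact mem (hU _ hW)
  | add hV hW ihV ihW =>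
    rename_i V W
    refine congr (ihV.add ihW) ?_
    filter_upwards [hV.eventually_contDiffAt hX, hW.eventually_contDiffAt hX] with y h1 h2
    exact lieBracket_add_right (h1.differentiableAt (by simp)) (h2.differentiableAt (by simp))
  | smul hf hV ih =>
    rename_i f V
    have hg : ∀ᶠ y in 𝓝 x₀, ContDiffAt ℝ ∞ (fun y => fderiv ℝ f y (U y)) y :=
      hf.mono fun y h =>
        (h.fderiv_right (m := ∞) (by exact_mod_cast le_top)).clm_apply hUc.contDiffAt
    refine congr ((smul hg hV).add (smul hf ih)) ?_
    filter_upwards [hf, hV.eventually_contDiffAt hX] with y h1 h2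
    rw [Pi.add_apply]
    exact lieBracket_smul_right (h1.differentiableAt (by simp)) (h2.differentiableAt (by simp))
  | congr hV hWV ih =>
    exact congr ih ((EventuallyEq.refl _ U).lieBracket_vectorField hWV)

/-- **Bracketing with ANY member of the family on the left keeps the restricted germ module.**
[folklore] -/
theorem lieBracket_family_left (hX : ∀ i, ContDiff ℝ ∞ (X i)) (i : κ) {W : E → E}
    (hW : InGermModuleMod X A x₀ W) : InGermModuleMod X A x₀ (lieBracket ℝ (X i) W) :=
  hW.lieBracket_right_of hX (hX i) fun _ hW' => lieBracket_family_mem_lieSpanMod hX i hW'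

/-- **Bracketing with ANY member of the family on the right keeps the restricted germ module.**
[folklore] -/
theorem lieBracket_family_right (hX : ∀ i, ContDiff ℝ ∞ (X i)) (i : κ) {W : E → E}
    (hW : InGermModuleMod X A x₀ W) : InGermModuleMod X A x₀ (lieBracket ℝ W (X i)) := by
  have e : lieBracket ℝ W (X i) = -lieBracket ℝ (X i) W := by
    funext y; rw [Pi.neg_apply]; exact lieBracket_swap
  rw [e]
  exact (hW.lieBracket_family_left hX i).neg

/-- The germ module is stable under bracketing with an element of `lieSpanMod` on the left.
[folklore] -/
theorem lieBracket_right (hX : ∀ i, ContDiff ℝ ∞ (X i)) {U : E → E} (hU : U ∈ lieSpanMod X A)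
    {W : E → E} (hW : InGermModuleMod X A x₀ W) : InGermModuleMod X A x₀ (lieBracket ℝ U W) :=
  hW.lieBracket_right_of hX (contDiff_of_mem_lieSpanMod hX hU)
    fun _ hW' => lieBracket_mem_lieSpanMod hX hU hW'

/-- **The restricted germ module is closed under the Lie bracket.** [folklore] -/
theorem lieBracket (hX : ∀ i, ContDiff ℝ ∞ (X i)) {V W : E → E} (hV : InGermModuleMod X A x₀ V)
    (hW : InGermModuleMod X A x₀ W) : InGermModuleMod X A x₀ (VectorField.lieBracket ℝ V W) := by
  induction hV with
  | mem hV => exact hW.lieBracket_right hX hV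
  | add hV₁ hV₂ ih₁ ih₂ =>
    rename_i V₁ V₂
    refine congr (ih₁.add ih₂) ?_
    filter_upwards [hV₁.eventually_contDiffAt hX, hV₂.eventually_contDiffAt hX] with y h1 h2
    exact lieBracket_add_left (h1.differentiableAt (by simp)) (h2.differentiableAt (by simp))
  | smul hf hV ih =>
    rename_i f V
    have hg : ∀ᶠ y in 𝓝 x₀, ContDiffAt ℝ ∞ (fun y => -(fderiv ℝ f y (W y))) y := by
      filter_upwards [hf, hW.eventually_contDiffAt hX] with y h1 h2
      exact ((h1.fderiv_right (m := ∞) (by exact_mod_cast le_top)).clm_apply h2).neg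
    refine congr ((smul hg hV).add (smul hf ih)) ?_
    filter_upwards [hf, hV.eventually_contDiffAt hX] with y h1 h2
    rw [Pi.add_apply, lieBracket_smul_left (h1.differentiableAt (by simp))
      (h2.differentiableAt (by simp)), neg_smul]
  | congr hV hWV ih =>
    exact congr ih (hWV.lieBracket_vectorField (EventuallyEq.refl _ W))

/-- Division by a coefficient non-vanishing at `x₀`. [folklore] -/
theorem of_smul_of_ne_zero {c : E → ℝ} {V : E → E}
    (hc : ∀ᶠ y in 𝓝 x₀, ContDiffAt ℝ ∞ c y) (hc0 : c x₀ ≠ 0)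
    (hV : InGermModuleMod X A x₀ (fun y => c y • V y)) : InGermModuleMod X A x₀ V := by
  have hcont : ContinuousAt c x₀ := hc.self_of_nhds.continuousAt
  have hne : ∀ᶠ y in 𝓝 x₀, c y ≠ 0 := hcont.eventually_ne hc0
  have hinv : ∀ᶠ y in 𝓝 x₀, ContDiffAt ℝ ∞ (fun y => (c y)⁻¹) y := by
    filter_upwards [hc, hne] with y h1 h2
    exact h1.inv h2
  refine congr (smul hinv hV) ?_
  filter_upwards [hne] with y hy
  simp [smul_smul, inv_mul_cancel₀ hy]

end InGermModuleMod

/-- **The restricted bracket condition at `x₀` from the restricted germ module.** [folklore] -/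
theorem bracketSpanModAt_eq_top_of_inGermModuleMod {x₀ : E} {S : Set E}
    (hS : Submodule.span ℝ S = ⊤) (h : ∀ v ∈ S, InGermModuleMod X A x₀ (fun _ => v)) :
    bracketSpanModAt X A x₀ = ⊤ := by
  rw [eq_top_iff, ← hS, Submodule.span_le]
  intro v hv
  exact (h v hv).apply_mem

/-! ### Rescaling by non-zero constants -/

section Rescale

variable {X' : κ → E → E} {c : κ → ℝ}

/-- Proper iterated brackets of the rescaled family `X' i = c i • X i` are non-zero... rather:
are constant multiples of proper iterated brackets of `X`. [folklore] -/
theorem IsProperIteratedLieBracket.exists_eq_smul_of_eq_smul (hX : ∀ i, ContDiff ℝ ∞ (X i))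
    (hX' : ∀ i, X' i = c i • X i) {V' : E → E} (hV' : IsProperIteratedLieBracket X' V') :
    ∃ (a : ℝ) (V : E → E), IsProperIteratedLieBracket X V ∧ V' = a • V := by
  cases hV' with
  | lieBracket i hW' =>
    rename_i W'
    obtain ⟨b, W, hW, rfl⟩ := hW'.exists_eq_smul_of_eq_smul hX hX'
    refine ⟨c i * b, VectorField.lieBracket ℝ (X i) W, IsProperIteratedLieBracket.lieBracket i hW, ?_⟩
    have hXd := (hX i).differentiable (by simp)
    have hWd := (hW.contDiff hX).differentiable (by simp)
    funext y
    rw [hX' i, Pi.smul_apply, lieBracket_const_smul_left (hXd y),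
      lieBracket_const_smul_right (hWd y), smul_smul]

/-- The restricted span of the rescaled family is contained in that of the original one.
[folklore] -/
theorem bracketSpanModAt_le_of_eq_smul (hX : ∀ i, ContDiff ℝ ∞ (X i)) (hX' : ∀ i, X' i = c i • X i)
    (x : E) : bracketSpanModAt X' A x ≤ bracketSpanModAt X A x := by
  refine Submodule.span_le.2 ?_
  rintro v ⟨V', hV', rfl⟩
  rcases hV' with ⟨i, hi, rfl⟩ | hV'
  · rw [hX' i, Pi.smul_apply]
    exact Submodule.smul_mem _ _ (Submodule.subset_span ⟨X i, Or.inl ⟨i, hi, rfl⟩, rfl⟩)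
  · obtain ⟨a, V, hV, rfl⟩ := hV'.exists_eq_smul_of_eq_smul hX hX'
    rw [Pi.smul_apply]
    exact Submodule.smul_mem _ a (Submodule.subset_span ⟨V, Or.inr hV, rfl⟩)

/-- **Rescaling by non-zero constants does not change the restricted span.** [folklore] -/
theorem bracketSpanModAt_eq_of_eq_smul (hX : ∀ i, ContDiff ℝ ∞ (X i)) (hX' : ∀ i, X' i = c i • X i)
    (hc : ∀ i, c i ≠ 0) (x : E) : bracketSpanModAt X' A x = bracketSpanModAt X A x := by
  refine le_antisymm (bracketSpanModAt_le_of_eq_smul hX hX' x) ?_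
  have hX'' : ∀ i, ContDiff ℝ ∞ (X' i) := fun i => by rw [hX' i]; exact (hX i).const_smul (c i)
  refine bracketSpanModAt_le_of_eq_smul (c := fun i => (c i)⁻¹) hX'' (fun i => ?_) x
  rw [hX' i, smul_smul, inv_mul_cancel₀ (hc i), one_smul]

end Rescale

/-! ### Lifting to space-time -/

/-- The lift `(t, y) ↦ (a, V y)` of a vector field on `E` to `ℝ × E` with constant time
component `a`. [folklore] -/
def liftField (a : ℝ) (V : E → E) : ℝ × E → ℝ × E := fun p => (a, V p.2)

omit [NormedAddCommGroup E] [NormedSpace ℝ E] in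
/-- Unfolding `liftField`. [folklore] -/
@[simp] theorem liftField_apply (a : ℝ) (V : E → E) (p : ℝ × E) : liftField a V p = (a, V p.2) := rfl

/-- Lifts of smooth fields are smooth. [folklore] -/
theorem contDiff_liftField {n : WithTop ℕ∞} (a : ℝ) {V : E → E} (hV : ContDiff ℝ n V) :
    ContDiff ℝ n (liftField a V) :=
  contDiff_const.prodMk (hV.comp contDiff_snd)

/-- The derivative of a lift: `D(liftField a V)(p)·w = (0, DV(p.2)·w.2)`. [folklore] -/
theorem hasFDerivAt_liftField (a : ℝ) {V : E → E} {p : ℝ × E} (hV : DifferentiableAt ℝ V p.2) :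
    HasFDerivAt (liftField a V)
      ((0 : ℝ × E →L[ℝ] ℝ).prod ((fderiv ℝ V p.2).comp (ContinuousLinearMap.snd ℝ ℝ E))) p :=
  (hasFDerivAt_const a p).prodMk (hV.hasFDerivAt.comp p hasFDerivAt_snd)

/-- **Brackets kill constant time components**: `[liftField a V, liftField b W] = liftField 0 [V, W]`.
[folklore] -/
theorem lieBracket_liftField {V W : E → E} (hV : Differentiable ℝ V) (hW : Differentiable ℝ W)
    (a b : ℝ) : lieBracket ℝ (liftField a V) (liftField b W) = liftField 0 (lieBracket ℝ V W) := by
  funext p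
  show fderiv ℝ (liftField b W) p (liftField a V p) - fderiv ℝ (liftField a V) p (liftField b W p) =
    ((0 : ℝ), VectorField.lieBracket ℝ V W p.2)
  rw [(hasFDerivAt_liftField b (hW p.2)).fderiv, (hasFDerivAt_liftField a (hV p.2)).fderiv]
  simp [VectorField.lieBracket]

section Lift

variable (c : κ → ℝ)

/-- Every iterated bracket of `X` lifts to an iterated bracket of the lifted family, with SOME
constant time component. [folklore] -/
theorem IsIteratedLieBracket.exists_lift (hX : ∀ i, ContDiff ℝ ∞ (X i)) {V : E → E}
    (hV : IsIteratedLieBracket X V) :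
    ∃ a : ℝ, IsIteratedLieBracket (fun i => liftField (c i) (X i)) (liftField a V) := by
  induction hV with
  | of i => exact ⟨c i, IsIteratedLieBracket.of i⟩
  | lieBracket i hW ih =>
    rename_i W
    obtain ⟨b, hb⟩ := ih
    refine ⟨0, ?_⟩
    have h := IsIteratedLieBracket.lieBracket (X := fun i => liftField (c i) (X i)) i hb
    rwa [lieBracket_liftField ((hX i).differentiable (by simp))
      ((hW.contDiff hX).differentiable (by simp))] at h

/-- Every PROPER iterated bracket of `X` lifts to a proper iterated bracket of the lifted
family with ZERO time component. [folklore] -/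
theorem IsProperIteratedLieBracket.lift (hX : ∀ i, ContDiff ℝ ∞ (X i)) {V : E → E}
    (hV : IsProperIteratedLieBracket X V) :
    IsProperIteratedLieBracket (fun i => liftField (c i) (X i)) (liftField 0 V) := by
  cases hV with
  | lieBracket i hW =>
    rename_i W
    obtain ⟨b, hb⟩ := hW.exists_lift c hX
    have h := IsProperIteratedLieBracket.lieBracket (X := fun i => liftField (c i) (X i)) i hb
    rwa [lieBracket_liftField ((hX i).differentiable (by simp))
      ((hW.contDiff hX).differentiable (by simp))] at h

/-- The restricted span of `X` at `y`, embedded as `{0} × ·`, lies in the bracket span of the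
lifted family at `(t, y)` when the allowed bare fields have zero time component. [folklore] -/
theorem inr_bracketSpanModAt_le (hX : ∀ i, ContDiff ℝ ∞ (X i)) (t : ℝ) (y : E) :
    (bracketSpanModAt X {i | c i = 0} y).map (LinearMap.inr ℝ ℝ E) ≤
      bracketSpanAt (fun i => liftField (c i) (X i)) (t, y) := by
  rw [Submodule.map_le_iff_le_comap, bracketSpanModAt, Submodule.span_le]
  rintro v ⟨V, hV, rfl⟩
  show ((0 : ℝ), V y) ∈ bracketSpanAt (fun i => liftField (c i) (X i)) (t, y)
  rcases hV with ⟨i, hi, rfl⟩ | hV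
  · have h0 : c i = 0 := hi
    refine Submodule.subset_span ⟨liftField (c i) (X i), IsIteratedLieBracket.of i, ?_⟩
    simp [h0]
  · exact Submodule.subset_span ⟨liftField 0 V, (hV.lift c hX).isIteratedLieBracket, by simp⟩

/-- **Lifting the bracket condition to space-time.** If the original family generates `E` at
every point of `s` WITHOUT the bare words of non-zero time component (`bracketSpanModAt` with the
allowed set `{i | c i = 0}`), and some field has a non-zero time component, then the lifted
family `i ↦ ((t, y) ↦ (c i, X i y))` satisfies Hörmander's bracket condition on `univ ×ˢ s` — the
bracket condition of the parabolic operator built from a Hörmander operator (Hörmander's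
Kolmogorov example). [cite: Hormander1967, Thm 1.1] -/
theorem isBracketGenerating_lift (hX : ∀ i, ContDiff ℝ ∞ (X i)) {s : Set E}
    (hgen : ∀ y ∈ s, bracketSpanModAt X {i | c i = 0} y = ⊤) {i₀ : κ} (hc : c i₀ ≠ 0) :
    IsBracketGenerating (fun i => liftField (c i) (X i)) ((univ : Set ℝ) ×ˢ s) := by
  rintro ⟨t, y⟩ ⟨-, hy⟩
  set S := bracketSpanAt (fun i => liftField (c i) (X i)) (t, y) with hS
  -- `{0} × E ⊆ S`
  have hE : ∀ v : E, ((0 : ℝ), v) ∈ S := fun v => by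
    have h := inr_bracketSpanModAt_le c hX t y
    rw [hgen y hy, Submodule.map_top] at h
    exact h (LinearMap.mem_range_self _ v)
  -- the time direction, from `X̃_{i₀}(t, y) = (c i₀, X_{i₀} y)`
  have hi₀ : ((c i₀), X i₀ y) ∈ S :=
    Submodule.subset_span ⟨liftField (c i₀) (X i₀), IsIteratedLieBracket.of i₀, rfl⟩
  have hT : ((1 : ℝ), (0 : E)) ∈ S := by
    have h1 : ((c i₀), (0 : E)) ∈ S := by
      have := Submodule.sub_mem _ hi₀ (hE (X i₀ y))
      simpa using this
    have h2 := Submodule.smul_mem _ (c i₀)⁻¹ h1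
    simpa [Prod.smul_mk, inv_mul_cancel₀ hc] using h2
  rw [eq_top_iff]
  rintro ⟨a, v⟩ -
  have e : ((a, v) : ℝ × E) = a • ((1 : ℝ), (0 : E)) + ((0 : ℝ), v) := by simp
  rw [e]
  exact Submodule.add_mem _ (Submodule.smul_mem _ a hT) (hE v)

end Lift

end Literature.Analysis.Distribution
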